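import Mathlib
import HarnessLib
import Summits.NavierStokesRegularity.NavierStokesRegularity.Theorems.PoloidalWindowDoorLrcModEntireTwistingTHSlopeFunction
import Summits.NavierStokesRegularity.NavierStokesRegularity.Theorems.PoloidalWindowDoorLrcModEntireRidgeHullTH

/-!
# Item `LrcModEntire` (stmt-NavierStokesRegularity-20428) — the `C³` SLOPE FUNCTION ON A UNIFORM SLAB (not only eventually near each point of the thread plane), and its
# TRANSFER TO HULL LIMITS with the same `μ`

ns-k2-port-2 g6 (helper prover under the LEAD of item 20428, ns-poloidal-K2-p3 g15; `--supports stmt-NavierStokesRegularity-20428 --as helper`).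
The LEAD's `…TwistingTHSlopeFunction.exists_slopeFunction_near_plane` (p707431) exports the slope form `∂₂v_b = μ(s,y₂)∂_b v₂` EVENTUALLY near every point `(−1, y)` of the thread
plane; its construction (ratio of two analytic Jacobian entries along `y₁ + z e₂`, cut off by bumps) actually gives the identity on the UNIFORM SPACE–TIME SLAB `|s+1| < ρ`,
`|x₂| < ρ`, for ALL `x` (global in the horizontal variables — the bilinear (TH) identity is global).  The uniform slab is the input form of port-2's
`…RidgeHullTH.slopeForm_of_hullLimit_slab` (refuter1 g21's K-317 interface note), so this file re-runs the construction with the stronger conclusion and composes: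

* `exists_slopeFunction_slab` — class (rate, continuity, Oseen-mild) + GLOBAL bilinear (TH) + a non-flat witness `∂_{c₁}v₂(−1,y₁) ≠ 0`, `y₁ ∈ P₀` ⇒ `∃ μ` (`uncurry μ ∈ C³`), `∃ ρ > 0`:
  the slope form on the slab (`|t+1| < ρ`, `|x₂| < ρ`, all `x`, `b ≠ 2`), the LEAD's eventual form at every point of `P₀`, and `μ(−1,0) =` the witness ratio
  — adapted from the LEAD's proof of `exists_slopeFunction_near_plane`;
* `slopeForm_hullLimit_slab` — for a hull limit along translation points IN `P₀` (hot points; slices converging locally uniformly at every `t < 0`), the limit `U` satisfies the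
  slope form with the SAME `μ` on the same slab, hence also the eventual form near every point of `P₀` at every time `|t+1| < ρ` — so `…TwistingTHRidgeLaw`,
  `…TwistingTHPlaneOscillation.weightSource_eq_of_height_eq` and `…RidgeWebLaw.laplacian_two_eq_of_webFermat` apply to `U` with `v`'s slope function.

WHAT THIS IS NOT: not a claim about Navier–Stokes regularity — plumbing for the (Q4) entrance (bears_on LADDER-NS N0, item 20428 / crux 19708; 20428/19708/27893 OPEN).
-/

noncomputable section

-- the summit and its single sub-problem share the name (CONVENTIONS §1), as in every Theorems file
set_option linter.dupNamespace false

namespace Summit.NavierStokesRegularity.NavierStokesRegularity.Theorems.PoloidalWindowDoorLrcModEntireTwistingTHSlopeSlab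

open Set Function Filter Topology Metric
open scoped ContDiff
open Literature.Analysis Literature.Analysis.FluidPDE
open Summit.NavierStokesRegularity.NavierStokesRegularity.Theorems.PoloidalWindowDoorLrcModEntireTwistingTHSlopeFunction
open Summit.NavierStokesRegularity.NavierStokesRegularity.Theorems.PoloidalWindowDoorLrcModEntireRidgeHullTH

variable {C : ℝ} {v : ℝ → EuclideanSpace ℝ (Fin 3) → EuclideanSpace ℝ (Fin 3)}

/-- **A `C³` SLOPE FUNCTION ON A UNIFORM SLAB.**  See the module docstring. -/
theorem exists_slopeFunction_slab (hrate : HasTypeITimeDecay C v) (hcont : ContinuousOn (uncurry v) (Iio (0 : ℝ) ×ˢ univ))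
    (hmild : ∀ s t : ℝ, s < t → t < 0 → ∀ x, v t x = UnboundedOperators.heatExtension (v s) (t - s) x - oseenDuhamel 1 s v v t x)
    (hTH : ∀ t < 0, ∀ x x' : EuclideanSpace ℝ (Fin 3), x 2 = x' 2 → ∀ b c : Fin 3, b ≠ 2 → c ≠ 2 →
      fderiv ℝ (v t) x (EuclideanSpace.single 2 1) b * fderiv ℝ (v t) x' (EuclideanSpace.single c 1) 2 =
        fderiv ℝ (v t) x' (EuclideanSpace.single 2 1) c * fderiv ℝ (v t) x (EuclideanSpace.single b 1) 2)
    {y₁ : EuclideanSpace ℝ (Fin 3)} (hy₁ : y₁ 2 = 0) {c₁ : Fin 3} (hc₁ : c₁ ≠ 2)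
    (hne : fderiv ℝ (v (-1)) y₁ (EuclideanSpace.single c₁ 1) 2 ≠ 0) :
    ∃ μ : ℝ → ℝ → ℝ, ∃ ρ : ℝ, 0 < ρ ∧ ContDiff ℝ 3 (uncurry μ) ∧
      (∀ t : ℝ, |t + 1| < ρ → ∀ x : EuclideanSpace ℝ (Fin 3), |x 2| < ρ → ∀ b : Fin 3, b ≠ 2 →
        fderiv ℝ (v t) x (EuclideanSpace.single 2 1) b = μ t (x 2) * fderiv ℝ (v t) x (EuclideanSpace.single b 1) 2) ∧
      (∀ y : EuclideanSpace ℝ (Fin 3), y 2 = 0 →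
        ∀ᶠ z in 𝓝 (((-1 : ℝ), y) : ℝ × EuclideanSpace ℝ (Fin 3)), ∀ b : Fin 3, b ≠ 2 →
          fderiv ℝ (v z.1) z.2 (EuclideanSpace.single 2 1) b = μ z.1 (z.2 2) * fderiv ℝ (v z.1) z.2 (EuclideanSpace.single b 1) 2) ∧
      μ (-1) 0 = fderiv ℝ (v (-1)) y₁ (EuclideanSpace.single 2 1) c₁ / fderiv ℝ (v (-1)) y₁ (EuclideanSpace.single c₁ 1) 2 := by
  -- adapted from the LEAD's `…TwistingTHSlopeFunction.exists_slopeFunction_near_plane` (same construction, slab conclusion kept)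
  set e₂ : EuclideanSpace ℝ (Fin 3) := EuclideanSpace.single 2 (1 : ℝ) with he₂
  set D : ℝ × ℝ → ℝ := fun q => fderiv ℝ (v q.1) (y₁ + q.2 • e₂) (EuclideanSpace.single c₁ 1) 2 with hD
  set Nn : ℝ × ℝ → ℝ := fun q => fderiv ℝ (v q.1) (y₁ + q.2 • e₂) (EuclideanSpace.single 2 1) c₁ with hNn
  have hDa : ∀ q : ℝ × ℝ, q.1 < 0 → AnalyticAt ℝ D q := fun q hq => analyticAt_entry_family hrate hcont hmild y₁ c₁ 2 hq
  have hNa : ∀ q : ℝ × ℝ, q.1 < 0 → AnalyticAt ℝ Nn q := fun q hq => analyticAt_entry_family hrate hcont hmild y₁ 2 c₁ hq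
  have h0 : ((-1 : ℝ), (0 : ℝ)).1 < 0 := by norm_num
  have hD0 : D ((-1 : ℝ), 0) ≠ 0 := by simpa [hD, he₂] using hne
  obtain ⟨ε, hε, hball⟩ : ∃ ε > 0, ∀ q : ℝ × ℝ, dist q ((-1 : ℝ), (0 : ℝ)) < ε → D q ≠ 0 := by
    have hev := ((hDa _ h0).continuousAt).eventually_ne hD0
    obtain ⟨ε, hε, h⟩ := Metric.eventually_nhds_iff.1 hev
    exact ⟨ε, hε, fun q hq => h hq⟩
  set ρ : ℝ := min ε (1 / 2) / 2 with hρ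
  have hρ0 : 0 < ρ := by rw [hρ]; positivity
  have hρε : 2 * ρ ≤ ε := by rw [hρ]; linarith [min_le_left ε (1/2)]
  have hρhalf : 2 * ρ ≤ 1 / 2 := by rw [hρ]; linarith [min_le_right ε (1/2)]
  have hbox : ∀ q : ℝ × ℝ, |q.1 + 1| < 2 * ρ → |q.2| < 2 * ρ → q.1 < 0 ∧ D q ≠ 0 := by
    intro q h1 h2
    refine ⟨by linarith [(abs_lt.1 h1).2], hball q ?_⟩
    rw [Prod.dist_eq, Real.dist_eq, Real.dist_eq, sub_zero, show q.1 - -1 = q.1 + 1 by ring]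
    exact lt_of_lt_of_le (max_lt h1 h2) hρε
  set g : ℝ × ℝ → ℝ := fun q => Nn q / D q with hg
  have hga : ∀ q : ℝ × ℝ, |q.1 + 1| < 2 * ρ → |q.2| < 2 * ρ → ContDiffAt ℝ 3 g q := by
    intro q h1 h2
    obtain ⟨hq, hDq⟩ := hbox q h1 h2
    exact ((hNa q hq).div (hDa q hq) hDq).contDiffAt
  let φ : ContDiffBump (-1 : ℝ) := ⟨ρ, 3 * ρ / 2, hρ0, by linarith⟩
  let ψ : ContDiffBump (0 : ℝ) := ⟨ρ, 3 * ρ / 2, hρ0, by linarith⟩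
  set χ : ℝ × ℝ → ℝ := fun q => φ q.1 * ψ q.2 with hχ
  have hχc : ContDiff ℝ 3 χ := ((φ.contDiff (n := 3)).comp contDiff_fst).mul ((ψ.contDiff (n := 3)).comp contDiff_snd)
  have hχ1 : ∀ q : ℝ × ℝ, |q.1 + 1| < ρ → |q.2| < ρ → χ q = 1 := by
    intro q h1 h2
    have e1 : φ q.1 = 1 := φ.one_of_mem_closedBall (by rw [mem_closedBall, Real.dist_eq, show q.1 - -1 = q.1 + 1 by ring]; exact h1.le)
    have e2 : ψ q.2 = 1 := ψ.one_of_mem_closedBall (by rw [mem_closedBall, Real.dist_eq, sub_zero]; exact h2.le)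
    simp [hχ, e1, e2]
  have hχ0 : ∀ q : ℝ × ℝ, ¬ (|q.1 + 1| < 2 * ρ ∧ |q.2| < 2 * ρ) → ∀ᶠ q' in 𝓝 q, χ q' = 0 := by
    intro q hq
    rcases not_and_or.1 hq with h | h
    · push Not at h
      have hev : ∀ᶠ q' : ℝ × ℝ in 𝓝 q, 3 * ρ / 2 < |q'.1 + 1| :=
        (continuous_abs.comp (continuous_fst.add continuous_const)).continuousAt.eventually
          (lt_mem_nhds (show 3 * ρ / 2 < |q.1 + 1| by linarith))
      filter_upwards [hev] with q' hq'
      have : φ q'.1 = 0 := φ.zero_of_le_dist (by rw [Real.dist_eq, show q'.1 - -1 = q'.1 + 1 by ring]; exact hq'.le)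
      simp [hχ, this]
    · push Not at h
      have hev : ∀ᶠ q' : ℝ × ℝ in 𝓝 q, 3 * ρ / 2 < |q'.2| :=
        (continuous_abs.comp continuous_snd).continuousAt.eventually (lt_mem_nhds (show 3 * ρ / 2 < |q.2| by linarith))
      filter_upwards [hev] with q' hq'
      have : ψ q'.2 = 0 := ψ.zero_of_le_dist (by rw [Real.dist_eq, sub_zero]; exact hq'.le)
      simp [hχ, this]
  -- the slope function and the SLAB identity
  set μ : ℝ → ℝ → ℝ := fun s z => χ (s, z) * g (s, z) with hμ
  have hslab : ∀ t : ℝ, |t + 1| < ρ → ∀ x : EuclideanSpace ℝ (Fin 3), |x 2| < ρ → ∀ b : Fin 3, b ≠ 2 →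
      fderiv ℝ (v t) x (EuclideanSpace.single 2 1) b = μ t (x 2) * fderiv ℝ (v t) x (EuclideanSpace.single b 1) 2 := by
    intro t ht x hx b hb
    obtain ⟨hs, hDz⟩ := hbox (t, x 2) (by simpa using lt_of_lt_of_le ht (by linarith)) (by simpa using lt_of_lt_of_le hx (by linarith))
    have hheight : x 2 = (y₁ + (x 2) • e₂) 2 := by simp [he₂, hy₁]
    have hbil := hTH t hs x (y₁ + (x 2) • e₂) hheight b c₁ hb hc₁
    show fderiv ℝ (v t) x (EuclideanSpace.single 2 1) b = χ (t, x 2) * g (t, x 2) * fderiv ℝ (v t) x (EuclideanSpace.single b 1) 2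
    rw [hχ1 (t, x 2) (by simpa using ht) (by simpa using hx), one_mul]
    simp only [hg, hNn, hD] at hDz ⊢
    field_simp
    linarith [hbil]
  refine ⟨μ, ρ, hρ0, ?_, hslab, ?_, ?_⟩
  · -- `C³`
    have e : uncurry μ = fun q => χ q * g q := by funext q; rfl
    rw [e]
    refine contDiff_iff_contDiffAt.2 fun q => ?_
    by_cases hq : |q.1 + 1| < 2 * ρ ∧ |q.2| < 2 * ρ
    · exact hχc.contDiffAt.mul (hga q hq.1 hq.2)
    · have hev := hχ0 q hq
      have hzero : (fun q => χ q * g q) =ᶠ[𝓝 q] fun _ => 0 := by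
        filter_upwards [hev] with q' hq'
        rw [hq', zero_mul]
      exact (contDiffAt_const (c := (0 : ℝ))).congr_of_eventuallyEq hzero
  · -- the eventual form near every point of the plane
    intro y hy
    have hU : ∀ᶠ z in 𝓝 (((-1 : ℝ), y) : ℝ × EuclideanSpace ℝ (Fin 3)), |z.1 + 1| < ρ ∧ |z.2 2| < ρ := by
      have h1 : ∀ᶠ z : ℝ × EuclideanSpace ℝ (Fin 3) in 𝓝 ((-1 : ℝ), y), |z.1 + 1| < ρ := by
        have hc : Continuous fun z : ℝ × EuclideanSpace ℝ (Fin 3) => |z.1 + 1| := continuous_abs.comp (continuous_fst.add continuous_const)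
        exact hc.continuousAt.eventually (gt_mem_nhds (show (fun z : ℝ × EuclideanSpace ℝ (Fin 3) => |z.1 + 1|) ((-1 : ℝ), y) < ρ by simpa using hρ0))
      have h2 : ∀ᶠ z : ℝ × EuclideanSpace ℝ (Fin 3) in 𝓝 ((-1 : ℝ), y), |z.2 2| < ρ := by
        have hc : Continuous fun z : ℝ × EuclideanSpace ℝ (Fin 3) => |z.2 2| :=
          continuous_abs.comp ((EuclideanSpace.proj (𝕜 := ℝ) (2 : Fin 3)).continuous.comp continuous_snd)
        exact hc.continuousAt.eventually (gt_mem_nhds (show (fun z : ℝ × EuclideanSpace ℝ (Fin 3) => |z.2 2|) ((-1 : ℝ), y) < ρ by simp only [hy, abs_zero]; exact hρ0))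
      exact h1.and h2
    filter_upwards [hU] with z hz b hb
    exact hslab z.1 hz.1 z.2 hz.2 b hb
  · -- the value at `(−1, 0)`
    show χ ((-1 : ℝ), 0) * g ((-1 : ℝ), 0) = _
    rw [hχ1 ((-1 : ℝ), 0) (by simp [hρ0]) (by simp [hρ0]), one_mul]
    simp [hg, hNn, hD, he₂]

/-- **THE SLOPE FUNCTION PASSES TO HULL LIMITS ALONG THE THREAD PLANE, slab and eventual forms.**  Class clauses of `v`, a slope function `μ` with the slab identity
(`|t+1| < ρ`, `|x₂| < ρ`), translation points `y_j ∈ P₀`, and `v(t, · + y_j) → U t` locally uniformly for every `t < 0` (`ρ ≤ 1`, so the slab times are negative) ⇒ `U`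
satisfies the slab identity with the SAME `μ`, and the eventual form near every point `(t₀, y)`, `|t₀+1| < ρ`, `y ∈ P₀`. -/
theorem slopeForm_hullLimit_slab (hrate : HasTypeITimeDecay C v) (hcont : ContinuousOn (uncurry v) (Iio (0 : ℝ) ×ˢ univ))
    (hmild : ∀ s t : ℝ, s < t → t < 0 → ∀ x, v t x = UnboundedOperators.heatExtension (v s) (t - s) x - oseenDuhamel 1 s v v t x)
    (hdiv : ∀ t < 0, VectorCalculus.IsDivFree (v t)) {μ : ℝ → ℝ → ℝ} {ρ : ℝ} (hρ1 : ρ ≤ 1)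
    (hslab : ∀ t : ℝ, |t + 1| < ρ → ∀ x : EuclideanSpace ℝ (Fin 3), |x 2| < ρ → ∀ b : Fin 3, b ≠ 2 →
      fderiv ℝ (v t) x (EuclideanSpace.single 2 1) b = μ t (x 2) * fderiv ℝ (v t) x (EuclideanSpace.single b 1) 2)
    {y : ℕ → EuclideanSpace ℝ (Fin 3)} (hy : ∀ j, y j 2 = 0) {U : ℝ → EuclideanSpace ℝ (Fin 3) → EuclideanSpace ℝ (Fin 3)}
    (hconv : ∀ t < 0, TendstoLocallyUniformly (fun j x => v t (x + y j)) (U t) atTop) :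
    (∀ t : ℝ, |t + 1| < ρ → ∀ x : EuclideanSpace ℝ (Fin 3), |x 2| < ρ → ∀ b : Fin 3, b ≠ 2 →
        fderiv ℝ (U t) x (EuclideanSpace.single 2 1) b = μ t (x 2) * fderiv ℝ (U t) x (EuclideanSpace.single b 1) 2) ∧
      (∀ t₀ : ℝ, |t₀ + 1| < ρ → ∀ y₀ : EuclideanSpace ℝ (Fin 3), y₀ 2 = 0 →
        ∀ᶠ z in 𝓝 ((t₀, y₀) : ℝ × EuclideanSpace ℝ (Fin 3)), ∀ b : Fin 3, b ≠ 2 →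
          fderiv ℝ (U z.1) z.2 (EuclideanSpace.single 2 1) b = μ z.1 (z.2 2) * fderiv ℝ (U z.1) z.2 (EuclideanSpace.single b 1) 2) := by
  have hslabU : ∀ t : ℝ, |t + 1| < ρ → ∀ x : EuclideanSpace ℝ (Fin 3), |x 2| < ρ → ∀ b : Fin 3, b ≠ 2 →
      fderiv ℝ (U t) x (EuclideanSpace.single 2 1) b = μ t (x 2) * fderiv ℝ (U t) x (EuclideanSpace.single b 1) 2 := by
    intro t ht x hx b hb
    have htneg : t < 0 := by linarith [(abs_lt.1 ht).2]
    exact slopeForm_of_hullLimit_slab hrate hcont hmild hdiv htneg (μ := μ t) (S := {z : ℝ | |z| < ρ})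
      (fun x' hx' b' hb' => hslab t ht x' hx' b' hb') hy (hconv t htneg) x hx b hb
  refine ⟨hslabU, fun t₀ ht₀ y₀ hy₀ => ?_⟩
  have hU : ∀ᶠ z in 𝓝 ((t₀, y₀) : ℝ × EuclideanSpace ℝ (Fin 3)), |z.1 + 1| < ρ ∧ |z.2 2| < ρ := by
    have h1 : ∀ᶠ z : ℝ × EuclideanSpace ℝ (Fin 3) in 𝓝 (t₀, y₀), |z.1 + 1| < ρ := by
      have hc : Continuous fun z : ℝ × EuclideanSpace ℝ (Fin 3) => |z.1 + 1| := continuous_abs.comp (continuous_fst.add continuous_const)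
      exact hc.continuousAt.eventually (gt_mem_nhds (show (fun z : ℝ × EuclideanSpace ℝ (Fin 3) => |z.1 + 1|) (t₀, y₀) < ρ by simpa using ht₀))
    have h2 : ∀ᶠ z : ℝ × EuclideanSpace ℝ (Fin 3) in 𝓝 (t₀, y₀), |z.2 2| < ρ := by
      have hc : Continuous fun z : ℝ × EuclideanSpace ℝ (Fin 3) => |z.2 2| :=
        continuous_abs.comp ((EuclideanSpace.proj (𝕜 := ℝ) (2 : Fin 3)).continuous.comp continuous_snd)
      have hρ0 : 0 < ρ := lt_of_le_of_lt (abs_nonneg _) ht₀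
      exact hc.continuousAt.eventually (gt_mem_nhds (show (fun z : ℝ × EuclideanSpace ℝ (Fin 3) => |z.2 2|) (t₀, y₀) < ρ by simp only [hy₀, abs_zero]; exact hρ0))
    exact h1.and h2
  filter_upwards [hU] with z hz b hb
  exact hslabU z.1 hz.1 z.2 hz.2 b hb

end Summit.NavierStokesRegularity.NavierStokesRegularity.Theorems.PoloidalWindowDoorLrcModEntireTwistingTHSlopeSlab

end
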